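import Literature.Topology.FourManifolds.TrisectionsSectorOneFunction
import Literature.Topology.FourManifolds.SPC4HandleChainProofs
import Literature.Topology.FourManifolds.MorseAffine
import HarnessLib

/-!
# A boundary-adapted function on the third sector `X₃` (towards "`X₃ ≅ ♮ᵏ S¹ × B³`",
# Gay–Kirby 2016, Lemma 14): the function and its first-order behaviour

Topic `Literature/Topology/FourManifolds`; for the fact seat
`provefact-Literature.Topology.FourManifolds.exists_isBalancedGKTrisection` (Gay–Kirby 2016,
Thm. 4 via Lemma 14).  Everything in this file is **proved**; no named facts are introduced.

The third sector `X₃ = closure S₃ ∪ {c ≤ f}` of `TriData` (Gay–Kirby's "`X₃` is what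
remains": the upside-down handlebody `{f ≥ 5/2}` with the column over the `H₃₁`-side of
`∂X₁⁰` attached) has, in its straightened structure (`TriData.cornerSliceAtlas₃`), the corner
locus `F` and the two faces `X₃ ∩ X₁ = {F₁ = 0}` (the bevel face) and `H₂₃ = {M̃ = 0}`.  As
for `X₁` (`TrisectionsSectorOneFunction.lean`), clause (ii) needs a function on `X` of corner
form near `F`, `1` on `∂X₃`, `< 1` and Morse inside, regular on `∂X₃ ∖ F`; this file
constructs it and proves everything but the Morse data at the critical points (sequel).

* `TriData.Mt` — the **extended interface function** `M̃`: `M` at points which hit the level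
  `∂X₁⁰`, `f - c` at points which do not; `M̃ ≥ 0` on `X₃`; boundary points of the
  straightened `X₃` = `F ∪ {F₁ = 0} ∪ {M̃ = 0}` (`isBoundaryPoint_iff₃'`); `M̃ = f - c` above
  `c + Γ + ε` (`|G| ≤ Γ`); `M̃` is smooth at the points of `X₃` — by the `λ`-lemma applied to
  the data with raised top level (`TriData.raise`) under the link condition.
* `SectorThreeParams` — the corner-form constant `c₀` (large against the band), `Γ`, the width
  `σ₀`, the slope bound of `χ₁` with the smallness of the bevel slope, and the **gap
  hypothesis** (no critical value of `f` in `(c, c + Γ + ε + σ₀]`; Gay–Kirby: `c = 5/2`, next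
  critical level `3`).
* the function **`F₃ = 1 - M̃ · Λ₃`**, `Λ₃ = (1 - ω(s)) (-U)/c₀ + ω(s) Ξ(s)` with the face
  function `U` of `X₁`, a ramp `ω` (`0` for `s ≤ ε_w`, `1` for `s ≥ (ε_w + δ_U)/2`;
  `rampUp`) and the increasing profile `Ξ` (`xiFun`: strictly increasing up to
  `S + σ₀ = c + Γ + ε - a + σ₀`, constant `1 + S` beyond): corner form `1 - u₃ v₃ / c₀` on the
  box, `= 1` on `∂X₃`, `< 1` inside, smooth at the points of `X₃`;
* **regularity**: along the unit-speed flow `F₃` strictly decreases at every interior point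
  which is not critical for `f` (`Ṁ̃ ≥ 0`, `Λ̇₃ > 0` below `S + σ₀`, `Ṁ̃ = ξ(f) > 0` above),
  so `F₃` has no critical points there (`not_isMCriticalPt_secFun₃_of_interior`); it is
  regular on the bevel face off `F` (flow derivative `-r Λ̇₃ < 0`) and on `{M̃ = 0}` off `F`
  (product rule at a regular zero of the straightening function of `M`, resp. of `f - c` at a
  sheet top).

## References

* D. Gay, R. Kirby, *Trisecting 4-manifolds*, Geom. Topol. 20 (2016) 3097–3132
  (arXiv:1205.1565): §4, Lemma 14 and its proof. [GayKirby2016]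
* J. Milnor, *Morse theory* (1963), Thm. 3.1 and §3. [Milnor1963]
-/

open scoped Manifold ContDiff Topology
open Set Function Filter

noncomputable section

universe u

namespace Literature.Topology.FourManifolds

variable {X : Type u} [TopologicalSpace X] [T2Space X] [CompactSpace X]
  [ChartedSpace (EuclideanSpace ℝ (Fin 4)) X] [IsManifold (𝓡 4) ∞ X]

namespace BiCollar

/-- **`G = g ∘ λ - b` is bounded** (`g` is continuous on the compact level `Y`). [folklore] -/
theorem exists_abs_gFun_le (B : BiCollar X) : ∃ Γ : ℝ, 0 ≤ Γ ∧ ∀ x, |B.gFun x| ≤ Γ := by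
  have hc : Continuous fun y : B.Y => B.g y - B.b := B.hg.contMDiff.continuous.sub continuous_const
  obtain ⟨Γ, hΓ⟩ := isCompact_univ.exists_bound_of_continuousOn (f := fun y : B.Y => B.g y - B.b) hc.continuousOn
  refine ⟨max Γ 0, le_max_right _ _, fun x => ?_⟩
  exact ((hΓ (B.lamLift x) (mem_univ _)).trans (le_max_left _ _) : ‖B.g (B.lamLift x) - B.b‖ ≤ max Γ 0)

namespace TriData

variable {B : BiCollar X} (T : B.TriData)

/-! ### Raising the top level -/

/-- **The same construction data with a higher top level `c''`** (regular for `f`): used to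
apply the `λ`-lemma above `c`. [folklore] -/
def raise (c'' : ℝ) (hcc : T.c ≤ c'') (hreg : ∀ x, B.f x = c'' → ¬ IsMCriticalPt (𝓡 4) B.f x) : B.TriData where
  Fr := T.Fr
  D := T.D
  c := c''
  band_le_c := T.band_le_c.trans hcc
  regular_c := hreg
  ε := T.ε
  ε_pos := T.ε_pos
  ε_le := by linarith [T.ε_le]

omit [T2Space X] [CompactSpace X] in
/-- The top level of `raise`. [folklore] -/
@[simp] theorem raise_c (c'' : ℝ) (hcc : T.c ≤ c'') (hreg : ∀ x, B.f x = c'' → ¬ IsMCriticalPt (𝓡 4) B.f x) :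
    (T.raise c'' hcc hreg).c = c'' := rfl

/-! ### The extended interface function `M̃` -/

open Classical in
/-- **The extended interface function** `M̃`: `M` at points which hit the level `∂X₁⁰`, `f - c`
at points which do not. [cite: GayKirby2016, §4, Lemma 14] -/
def Mt (x : X) : ℝ := if B.Hit x then T.M x else B.f x - T.c

/-- `M̃ = M` at points which hit. [folklore] -/
theorem Mt_of_hit {x : X} (hx : B.Hit x) : T.Mt x = T.M x := by
  classical
  exact if_pos hx

/-- `M̃ = f - c` at points which do not hit. [folklore] -/
theorem Mt_of_not_hit {x : X} (hx : ¬ B.Hit x) : T.Mt x = B.f x - T.c := by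
  classical
  exact if_neg hx

/-- Near a point which hits, `M̃ = M`. [folklore] -/
theorem Mt_eventuallyEq_M {x : X} (hx : B.Hit x) : T.Mt =ᶠ[𝓝 x] T.M := by
  filter_upwards [T.Fr.isOpen_setOf_hit.mem_nhds hx] with y hy
  exact T.Mt_of_hit hy

/-- `M̃` is smooth at points which hit. [folklore] -/
theorem contMDiffAt_Mt_of_hit {x : X} (hx : B.Hit x) : ContMDiffAt (𝓡 4) 𝓘(ℝ, ℝ) ∞ T.Mt x :=
  (T.contMDiffAt_M hx).congr_of_eventuallyEq (T.Mt_eventuallyEq_M hx)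

/-- **High above the top level, `M = f - c`**: if `|G| ≤ Γ` and `c + Γ + ε ≤ f x` then
`w x ≥ ε`. [cite: GayKirby2016, §4, Lemma 14] -/
theorem M_eq_sub_of_le_f {Γ : ℝ} (hΓ : ∀ x, |B.gFun x| ≤ Γ) {x : X} (hx : T.c + Γ + T.ε ≤ B.f x) :
    T.M x = B.f x - T.c := by
  apply T.M_eq_sub_of_le_w
  have h := (abs_le.1 (hΓ x)).2
  show T.ε ≤ B.f x - T.c - B.gFun x
  linarith

/-- High above the top level, `M̃ = f - c`. [folklore] -/
theorem Mt_eq_sub_of_le_f {Γ : ℝ} (hΓ : ∀ x, |B.gFun x| ≤ Γ) {x : X} (hx : T.c + Γ + T.ε ≤ B.f x) :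
    T.Mt x = B.f x - T.c := by
  by_cases hh : B.Hit x
  · rw [T.Mt_of_hit hh, T.M_eq_sub_of_le_f hΓ hx]
  · exact T.Mt_of_not_hit hh

/-- High above the top level, `M̃ = f - c` near the point. [folklore] -/
theorem Mt_eventuallyEq_sub_of_lt_f {Γ : ℝ} (hΓ : ∀ x, |B.gFun x| ≤ Γ) {x : X} (hx : T.c + Γ + T.ε < B.f x) :
    T.Mt =ᶠ[𝓝 x] fun y => B.f y - T.c := by
  filter_upwards [(isOpen_lt continuous_const B.U.contMDiff_f.continuous).mem_nhds hx] with y hy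
  exact T.Mt_eq_sub_of_le_f hΓ hy.le

/-- **A point of `X₃` which does not hit lies on or above the top level** (a sheet point
below `c` has `X₂` as a neighbourhood avoiding `X₃`). [cite: GayKirby2016, §4, Lemma 14] -/
theorem c_le_f_of_mem_X₃_of_not_hit {η : ℝ} (hη : 2 * T.ε ≤ η)
    (hL : ∀ q : X, IsMCriticalPt (𝓡 4) B.f q → B.a < B.f q → B.f q ≤ T.c →
      ∀ y : B.Y, RegularLevel.incl B.hf y ∈ stableSet (𝓡 4) B.U.ξ q → B.g y < B.b - η)
    {x : X} (hx3 : x ∈ T.X₃) (hx : ¬ B.Hit x) : T.c ≤ B.f x := by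
  by_contra hlt
  have hlt' : B.f x < T.c := not_le.1 hlt
  have hx₁ : x ∉ T.X₁ := fun h1 => by
    -- in `X₁ ∩ X₃` one has `F₁ = 0`, so `x` is in the band and hits
    have h0 : T.D.F₁ x = 0 := T.F₁_eq_zero_of_mem_X₁_X₃ h1 hx3
    exact hx (B.hit_of_mem_band (T.D.mem_band_of_F₁_eq_zero h0))
  have hsh : x ∈ T.sheets := ⟨T.a_le_of_not_mem_X₁_of_not_hit hx₁ hx, hlt'.le, hx⟩
  have h := (T.X₂_mem_nhds_of_mem_sheets (T.ε_lt_η hη) hL hsh hx₁ hlt').2.self_of_nhds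
  exact h hx3

/-- **`M̃ ≥ 0` on `X₃`.** [cite: GayKirby2016, §4, Lemma 14] -/
theorem Mt_nonneg_of_mem_X₃ {η : ℝ} (hη : 2 * T.ε ≤ η)
    (hL : ∀ q : X, IsMCriticalPt (𝓡 4) B.f q → B.a < B.f q → B.f q ≤ T.c →
      ∀ y : B.Y, RegularLevel.incl B.hf y ∈ stableSet (𝓡 4) B.U.ξ q → B.g y < B.b - η)
    {x : X} (hx3 : x ∈ T.X₃) : 0 ≤ T.Mt x := by
  by_cases hh : B.Hit x
  · rw [T.Mt_of_hit hh]; exact T.M_nonneg_of_mem_X₃ hh hx3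
  · rw [T.Mt_of_not_hit hh]; linarith [T.c_le_f_of_mem_X₃_of_not_hit hη hL hx3 hh]

section Boundary

variable (hc2 : B.a + B.U.δ + 2 * T.ε ≤ T.c) {η : ℝ} (hη : 2 * T.ε ≤ η)
  (hL : ∀ q : X, IsMCriticalPt (𝓡 4) B.f q → B.a < B.f q → B.f q ≤ T.c →
    ∀ y : B.Y, RegularLevel.incl B.hf y ∈ stableSet (𝓡 4) B.U.ξ q → B.g y < B.b - η)

/-- **The boundary points of the straightened `X₃`** are the points of `F`, of the bevel face
`{F₁ = 0}` and of `{M̃ = 0}`. [cite: GayKirby2016, Def. 1 and §4, Lemma 14] -/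
theorem isBoundaryPoint_iff₃' (p : T.X₃) :
    letI := (T.cornerSliceAtlas₃ hc2 hη hL).chartedSpace
    (𝓡∂ 4).IsBoundaryPoint p ↔ p.1 ∈ B.surface ∨ T.D.F₁ p.1 = 0 ∨ T.Mt p.1 = 0 := by
  rw [T.isBoundaryPoint_iff₃ hc2 hη hL p]
  constructor
  · rintro (h | h | ⟨hh, hM⟩ | ⟨hh, hc⟩)
    · exact Or.inl h
    · exact Or.inr (Or.inl h)
    · exact Or.inr (Or.inr (by rw [T.Mt_of_hit hh]; exact hM))
    · exact Or.inr (Or.inr (by rw [T.Mt_of_not_hit hh]; linarith))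
  · rintro (h | h | hM)
    · exact Or.inl h
    · exact Or.inr (Or.inl h)
    · by_cases hh : B.Hit p.1
      · exact Or.inr (Or.inr (Or.inl ⟨hh, by rwa [T.Mt_of_hit hh] at hM⟩))
      · exact Or.inr (Or.inr (Or.inr ⟨hh, by rw [T.Mt_of_not_hit hh] at hM; linarith⟩))

/-- **The interior points of the straightened `X₃`** are the points off `F`, off the bevel
face and with `M̃ ≠ 0` (then `M̃ > 0`). [cite: GayKirby2016, Def. 1 and §4, Lemma 14] -/
theorem isInteriorPoint_iff₃ (p : T.X₃) :
    letI := (T.cornerSliceAtlas₃ hc2 hη hL).chartedSpace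
    (𝓡∂ 4).IsInteriorPoint p ↔ p.1 ∉ B.surface ∧ T.D.F₁ p.1 ≠ 0 ∧ T.Mt p.1 ≠ 0 := by
  letI := (T.cornerSliceAtlas₃ hc2 hη hL).chartedSpace
  rw [(𝓡∂ 4).isInteriorPoint_iff_not_isBoundaryPoint, T.isBoundaryPoint_iff₃' hc2 hη hL]
  tauto

end Boundary

/-! ### Smoothness of `M̃` at the points which do not hit -/

section NotHit

variable {c'' η : ℝ} (hcc : T.c ≤ c'') (hreg : ∀ x, B.f x = c'' → ¬ IsMCriticalPt (𝓡 4) B.f x)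
  (hη : 2 * T.ε ≤ η)
  (hL'' : ∀ q : X, IsMCriticalPt (𝓡 4) B.f q → B.a < B.f q → B.f q ≤ c'' →
    ∀ y : B.Y, RegularLevel.incl B.hf y ∈ stableSet (𝓡 4) B.U.ξ q → B.g y < B.b - η)

include hcc hreg hη hL'' in
/-- **Near a point which does not hit (with `c ≤ f ≤ c''`), `M̃ = f - c`**: by the `λ`-lemma
for the raised data, nearby points which hit land in `{g < b - η}`, so that `w ≥ ε` and
`M = f - c` there. [cite: GayKirby2016, §4, Lemma 14] -/
theorem Mt_eventuallyEq_sub_of_not_hit {x : X} (hx : ¬ B.Hit x) (hcx : T.c ≤ B.f x) (hxc : B.f x ≤ c'') :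
    T.Mt =ᶠ[𝓝 x] fun y => B.f y - T.c := by
  -- `x` is a sheet point of the raised data
  have ha : B.a ≤ B.f x := by linarith [T.band_le_c, B.U.δ_pos]
  have hsh : x ∈ (T.raise c'' hcc hreg).sheets := ⟨ha, hxc, hx⟩
  have h1 := (T.raise c'' hcc hreg).eventually_g_lamLift_lt_of_mem_sheets hL'' hsh
  have h2 : ∀ᶠ y in 𝓝 x, T.c - T.ε < B.f y :=
    (isOpen_lt continuous_const B.U.contMDiff_f.continuous).mem_nhds
      (by show T.c - T.ε < B.f x; linarith [T.ε_pos])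
  filter_upwards [h1, h2] with y hy hyc
  by_cases hh : B.Hit y
  · rw [T.Mt_of_hit hh]
    apply T.M_eq_sub_of_le_w
    have hG : B.gFun y < -η := by have := hy hh; show B.g (B.lamLift y) - B.b < -η; linarith
    show T.ε ≤ B.f y - T.c - B.gFun y
    linarith
  · exact T.Mt_of_not_hit hh

include hcc hreg hη hL'' in
/-- `M̃` is smooth at the points which do not hit, with `c ≤ f ≤ c''`. [folklore] -/
theorem contMDiffAt_Mt_of_not_hit {x : X} (hx : ¬ B.Hit x) (hcx : T.c ≤ B.f x) (hxc : B.f x ≤ c'') :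
    ContMDiffAt (𝓡 4) 𝓘(ℝ, ℝ) ∞ T.Mt x :=
  (B.U.contMDiff_f.contMDiffAt.sub contMDiffAt_const).congr_of_eventuallyEq
    (T.Mt_eventuallyEq_sub_of_not_hit hcc hreg hη hL'' hx hcx hxc)

include hcc hreg hη hL'' in
/-- **`M̃` is smooth at every point of `X₃`** provided `|G| ≤ Γ` with `c + Γ + ε < c''` and
the link condition holds up to `c''`. [folklore] -/
theorem contMDiffAt_Mt {Γ : ℝ} (hΓ : ∀ x, |B.gFun x| ≤ Γ) (hΓc : T.c + Γ + T.ε < c'') {x : X} (hx3 : x ∈ T.X₃) :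
    ContMDiffAt (𝓡 4) 𝓘(ℝ, ℝ) ∞ T.Mt x := by
  by_cases hh : B.Hit x
  · exact T.contMDiffAt_Mt_of_hit hh
  · have hL : ∀ q : X, IsMCriticalPt (𝓡 4) B.f q → B.a < B.f q → B.f q ≤ T.c →
        ∀ y : B.Y, RegularLevel.incl B.hf y ∈ stableSet (𝓡 4) B.U.ξ q → B.g y < B.b - η :=
      fun q hq h1 h2 => hL'' q hq h1 (h2.trans hcc)
    have hcx := T.c_le_f_of_mem_X₃_of_not_hit hη hL hx3 hh
    by_cases hxc : B.f x ≤ c''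
    · exact T.contMDiffAt_Mt_of_not_hit hcc hreg hη hL'' hh hcx hxc
    · exact (B.U.contMDiff_f.contMDiffAt.sub contMDiffAt_const).congr_of_eventuallyEq
        (T.Mt_eventuallyEq_sub_of_lt_f hΓ (by linarith [not_le.1 hxc]))

end NotHit

/-! ### The increasing profile `Ξ` -/

section Xi

variable (σ₀ S : ℝ)

/-- **The increasing profile** `Ξ(s) = 1 + σ_{σ₀}(s) - σ_{σ₀}(s - S)`: smooth, `≥ 1`, with
derivative `step(s/σ₀) - step((s - S)/σ₀) ≥ 0`, positive for `-σ₀ < s < S + σ₀` when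
`S ≥ 2σ₀`, and constant `1 + S` for `s ≥ S + σ₀`. [folklore] -/
def xiFun (s : ℝ) : ℝ := 1 + creaseσ σ₀ s - creaseσ σ₀ (s - S)

variable {σ₀ S} (hσ : 0 < σ₀) (hS : 2 * σ₀ ≤ S)

/-- `Ξ` is smooth. [folklore] -/
theorem contDiff_xiFun : ContDiff ℝ ∞ (xiFun σ₀ S) :=
  (contDiff_const.add (contDiff_creaseσ σ₀)).sub ((contDiff_creaseσ σ₀).comp (contDiff_id.sub contDiff_const))

include hσ in
/-- The derivative of `Ξ`. [folklore] -/
theorem hasDerivAt_xiFun (s : ℝ) :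
    HasDerivAt (xiFun σ₀ S) (creaseStep (s / σ₀) - creaseStep ((s - S) / σ₀)) s := by
  have h1 := hasDerivAt_creaseσ hσ s
  have h2 : HasDerivAt (fun x => creaseσ σ₀ (x - S)) (creaseStep ((s - S) / σ₀)) s :=
    (hasDerivAt_creaseσ hσ (s - S)).comp_sub_const s S
  have h := (h1.const_add 1).sub h2
  exact h

include hσ in
/-- `Ξ' ≥ 0`. [folklore] -/
theorem deriv_xiFun_nonneg (hS0 : 0 ≤ S) (s : ℝ) : 0 ≤ deriv (xiFun σ₀ S) s := by
  rw [(hasDerivAt_xiFun hσ s).deriv, sub_nonneg]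
  exact monotone_creaseStep (by rw [div_le_div_iff_of_pos_right hσ]; linarith)

include hσ hS in
/-- **`Ξ' > 0` on `(-σ₀, S + σ₀)`** (with `S ≥ 2σ₀` the two crease steps never sit in the
open transition zone together). [folklore] -/
theorem deriv_xiFun_pos {s : ℝ} (h1 : -σ₀ < s) (h2 : s < S + σ₀) : 0 < deriv (xiFun σ₀ S) s := by
  rw [(hasDerivAt_xiFun hσ s).deriv, sub_pos]
  by_cases hs : 1 ≤ s / σ₀
  · rw [creaseStep_of_one_le hs]
    exact creaseStep_lt_one (by rw [div_lt_one hσ]; linarith)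
  · have hlt : s / σ₀ < 1 := not_le.1 hs
    have hy : (s - S) / σ₀ ≤ -1 := by
      rw [div_le_iff₀ hσ]
      have : s < σ₀ := by rwa [div_lt_one hσ] at hlt
      linarith
    rw [creaseStep_of_le_neg_one hy]
    exact creaseStep_pos (by rw [lt_div_iff₀ hσ]; linarith)

include hσ in
/-- `1 ≤ Ξ`. [folklore] -/
theorem one_le_xiFun (hS0 : 0 ≤ S) (s : ℝ) : 1 ≤ xiFun σ₀ S s := by
  rw [xiFun]
  have := monotone_creaseσ hσ (show s - S ≤ s by linarith)
  linarith

include hσ in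
/-- **`Ξ = 1 + S` for `s ≥ S + σ₀`.** [folklore] -/
theorem xiFun_of_le {s : ℝ} (hS0 : 0 ≤ S) (hs : S + σ₀ ≤ s) : xiFun σ₀ S s = 1 + S := by
  rw [xiFun, creaseσ_of_le hσ (by linarith), creaseσ_of_le hσ (by linarith)]; ring

include hσ in
/-- `Ξ' = 0` for `s ≥ S + σ₀`. [folklore] -/
theorem deriv_xiFun_of_le {s : ℝ} (hS0 : 0 ≤ S) (hs : S + σ₀ ≤ s) : deriv (xiFun σ₀ S) s = 0 := by
  rw [(hasDerivAt_xiFun hσ s).deriv, creaseStep_of_one_le (by rw [le_div_iff₀ hσ]; linarith),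
    creaseStep_of_one_le (by rw [le_div_iff₀ hσ]; linarith), sub_self]

end Xi

/-! ### A smooth ramp from `0` to `1` with controlled derivative -/

section Ramp

variable (s₁ s₂ σ₁ : ℝ)

/-- **The ramp** `(σ(s - s₁) - σ(s - s₂)) / (s₂ - s₁)` (crease profiles of width `σ₁`): `0` for
`s ≤ s₁ - σ₁`, `1` for `s ≥ s₂ + σ₁`, valued in `[0, 1]`, with derivative
`(step - step)/(s₂ - s₁) ≥ 0`. [folklore] -/
def rampUp (s : ℝ) : ℝ := (creaseσ σ₁ (s - s₁) - creaseσ σ₁ (s - s₂)) / (s₂ - s₁)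

variable {s₁ s₂ σ₁} (hσ : 0 < σ₁) (h12 : s₁ < s₂)

/-- The ramp is smooth. [folklore] -/
theorem contDiff_rampUp : ContDiff ℝ ∞ (rampUp s₁ s₂ σ₁) :=
  (((contDiff_creaseσ σ₁).comp (contDiff_id.sub contDiff_const)).sub
    ((contDiff_creaseσ σ₁).comp (contDiff_id.sub contDiff_const))).div_const _

include hσ in
/-- `creaseσ` is `1`-Lipschitz from above: `σ x - σ y ≤ x - y` for `y ≤ x`. [folklore] -/
theorem creaseσ_sub_le {x y : ℝ} (h : y ≤ x) : creaseσ σ₁ x - creaseσ σ₁ y ≤ x - y := by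
  have hanti : Antitone fun t => creaseσ σ₁ t - t := by
    apply antitone_of_deriv_nonpos
    · exact (contDiff_creaseσ σ₁).differentiable (by simp) |>.sub differentiable_id
    · intro t
      have hd : HasDerivAt (fun t => creaseσ σ₁ t - t) (creaseStep (t / σ₁) - 1) t :=
        (hasDerivAt_creaseσ hσ t).sub (hasDerivAt_id t)
      rw [hd.deriv]
      linarith [creaseStep_le_one (t / σ₁)]
  have := hanti h
  simp only at this
  linarith

include hσ h12 in
/-- `0 ≤ ramp ≤ 1`. [folklore] -/
theorem rampUp_mem (s : ℝ) : rampUp s₁ s₂ σ₁ s ∈ Icc (0 : ℝ) 1 := by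
  have hpos : 0 < s₂ - s₁ := by linarith
  refine ⟨div_nonneg ?_ hpos.le, ?_⟩
  · linarith [monotone_creaseσ hσ (show s - s₂ ≤ s - s₁ by linarith)]
  · rw [rampUp, div_le_one hpos]
    linarith [creaseσ_sub_le hσ (show s - s₂ ≤ s - s₁ by linarith)]

include hσ h12 in
/-- `ramp = 0` for `s ≤ s₁ - σ₁`. [folklore] -/
theorem rampUp_of_le {s : ℝ} (hs : s ≤ s₁ - σ₁) : rampUp s₁ s₂ σ₁ s = 0 := by
  rw [rampUp, creaseσ_of_le_neg hσ (by linarith), creaseσ_of_le_neg hσ (by linarith), sub_self, zero_div]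

include hσ h12 in
/-- `ramp = 1` for `s₂ + σ₁ ≤ s`. [folklore] -/
theorem rampUp_of_ge {s : ℝ} (hs : s₂ + σ₁ ≤ s) : rampUp s₁ s₂ σ₁ s = 1 := by
  rw [rampUp, creaseσ_of_le hσ (by linarith), creaseσ_of_le hσ (by linarith)]
  rw [div_eq_one_iff_eq (by linarith)]; ring

include hσ in
/-- The derivative of the ramp. [folklore] -/
theorem hasDerivAt_rampUp (s : ℝ) :
    HasDerivAt (rampUp s₁ s₂ σ₁) ((creaseStep ((s - s₁) / σ₁) - creaseStep ((s - s₂) / σ₁)) / (s₂ - s₁)) s := by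
  have h1 : HasDerivAt (fun x => creaseσ σ₁ (x - s₁)) (creaseStep ((s - s₁) / σ₁)) s :=
    (hasDerivAt_creaseσ hσ (s - s₁)).comp_sub_const s s₁
  have h2 : HasDerivAt (fun x => creaseσ σ₁ (x - s₂)) (creaseStep ((s - s₂) / σ₁)) s :=
    (hasDerivAt_creaseσ hσ (s - s₂)).comp_sub_const s s₂
  exact (h1.sub h2).div_const _

include hσ h12 in
/-- The derivative of the ramp is nonnegative. [folklore] -/
theorem deriv_rampUp_nonneg (s : ℝ) : 0 ≤ deriv (rampUp s₁ s₂ σ₁) s := by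
  rw [(hasDerivAt_rampUp hσ s).deriv]
  apply div_nonneg _ (by linarith)
  linarith [monotone_creaseStep (show (s - s₂) / σ₁ ≤ (s - s₁) / σ₁ by
    rw [div_le_div_iff_of_pos_right hσ]; linarith)]

include hσ h12 in
/-- The derivative of the ramp vanishes for `s < s₁ - σ₁`. [folklore] -/
theorem deriv_rampUp_of_lt {s : ℝ} (hs : s ≤ s₁ - σ₁) : deriv (rampUp s₁ s₂ σ₁) s = 0 := by
  rw [(hasDerivAt_rampUp hσ s).deriv, creaseStep_of_le_neg_one (by rw [div_le_iff₀ hσ]; linarith),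
    creaseStep_of_le_neg_one (by rw [div_le_iff₀ hσ]; linarith), sub_self, zero_div]

end Ramp

/-! ### The cut-off `ω` in `s` -/

/-- The upper end of the transition of `ω`: `(ε_w + δ_U)/2`. [folklore] -/
def sMid : ℝ := (T.D.εw + B.U.δ) / 2

/-- The width of the crease profiles of `ω`: `(sMid - ε_w)/4`. [folklore] -/
def σω : ℝ := (T.sMid - T.D.εw) / 4

/-- **`ω = rampUp (εw + σ) (sMid - σ) σ ∘ s`**: `0` for `s ≤ ε_w`, `1` for `s ≥ sMid`. [folklore] -/
def omegaFun (x : X) : ℝ := rampUp (T.D.εw + T.σω) (T.sMid - T.σω) T.σω (B.sFun x)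

omit [T2Space X] [CompactSpace X] in
/-- `ε_w < sMid`. [folklore] -/
theorem εw_lt_mid : T.D.εw < T.sMid := by
  have h : T.D.εw < B.U.δ := (min_le_left _ _).trans_lt (T.D.χ₁.rIn_lt_rOut.trans T.D.rOut₁_lt)
  show T.D.εw < (T.D.εw + B.U.δ) / 2
  linarith

omit [T2Space X] [CompactSpace X] in
/-- `sMid < δ_U`. [folklore] -/
theorem mid_lt_δ : T.sMid < B.U.δ := by
  have h : T.D.εw < B.U.δ := (min_le_left _ _).trans_lt (T.D.χ₁.rIn_lt_rOut.trans T.D.rOut₁_lt)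
  show (T.D.εw + B.U.δ) / 2 < B.U.δ
  linarith

omit [T2Space X] [CompactSpace X] in
/-- `0 < σω`. [folklore] -/
theorem σω_pos : 0 < T.σω := by
  have := T.εw_lt_mid; show 0 < (T.sMid - T.D.εw) / 4; linarith

omit [T2Space X] [CompactSpace X] in
/-- The ends of the ramp are ordered. [folklore] -/
theorem ramp_lt : T.D.εw + T.σω < T.sMid - T.σω := by
  have := T.εw_lt_mid
  show T.D.εw + (T.sMid - T.D.εw) / 4 < T.sMid - (T.sMid - T.D.εw) / 4
  linarith

omit [T2Space X] [CompactSpace X] in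
/-- `0 ≤ ω ≤ 1`. [folklore] -/
theorem omegaFun_mem (x : X) : T.omegaFun x ∈ Icc (0 : ℝ) 1 := rampUp_mem T.σω_pos T.ramp_lt _

omit [T2Space X] [CompactSpace X] in
/-- **`ω = 0` for `s ≤ ε_w`** (in particular on the box and on the bevel face). [folklore] -/
theorem omegaFun_of_le {x : X} (hx : B.sFun x ≤ T.D.εw) : T.omegaFun x = 0 :=
  rampUp_of_le T.σω_pos T.ramp_lt (by show B.sFun x ≤ T.D.εw + T.σω - T.σω; linarith)

omit [T2Space X] [CompactSpace X] in
/-- **`ω = 1` for `sMid ≤ s`** (in particular off the band above the level). [folklore] -/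
theorem omegaFun_of_ge {x : X} (hx : T.sMid ≤ B.sFun x) : T.omegaFun x = 1 :=
  rampUp_of_ge T.σω_pos T.ramp_lt (by show T.sMid - T.σω + T.σω ≤ B.sFun x; linarith)

omit [T2Space X] [CompactSpace X] in
/-- If `ω < 1` then `s < sMid`. [folklore] -/
theorem sFun_lt_of_omegaFun_lt_one {x : X} (h : T.omegaFun x < 1) : B.sFun x < T.sMid := by
  by_contra h'
  exact h.ne (T.omegaFun_of_ge (not_lt.1 h'))

/-- **On the box, `M̃ = r = v₃`.** [cite: GayKirby2016, Def. 1 and Fig. 1] -/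
theorem Mt_of_mem_box {x : X} (hx : x ∈ B.box T.D.εw) : T.Mt x = B.vFun T.frame₃ x := by
  rw [T.Mt_of_hit (B.hit_of_mem_band (B.mem_band_U (hx.1.trans_le T.D.εw_le_δU))), T.M_eq_rFun_of_mem_box hx,
    T.vFun_frame₃]


/-! ### Parameters of the function on `X₃` -/

/-- **Parameters of the adapted function on `X₃`**: the corner-form constant `c₀` (large
against the band: `(−U)/c₀ ≤ 1/2` there), a bound `Γ` of `|G|`, the width `σ₀` of the top
transition of the profile `Ξ`, a slope bound `L` for `χ₁` with the smallness of the bevel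
slope, and the **gap hypothesis**: no critical point of `f` has its value in
`(c, c + Γ + ε + σ₀]` (in Gay–Kirby's setting: `c = 5/2`, the next critical level is `3`).
[folklore] -/
structure SectorThreeParams where
  /-- Corner-form constant. -/
  c₀ : ℝ
  /-- Bound of `|G|`. -/
  Γ : ℝ
  /-- Width of the top transition. -/
  σ₀ : ℝ
  /-- A bound for `|χ₁'|`. -/
  L : ℝ
  c₀_ge : 2 * (B.U.δ + T.D.κ * T.D.χ₂.rOut) ≤ c₀
  abs_gFun_le : ∀ x, |B.gFun x| ≤ Γ
  σ₀_pos : 0 < σ₀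
  σ₀_le : 2 * σ₀ ≤ B.U.δ
  abs_deriv_le : ∀ s, |deriv T.D.χ₁ s| ≤ L
  hκ : T.D.κ * L * T.D.χ₂.rOut ≤ 1 / 4
  gap : ∀ q, IsMCriticalPt (𝓡 4) B.f q → B.f q ≤ T.c ∨ T.c + Γ + T.ε + σ₀ < B.f q

/-- **Parameters exist** as soon as the bevel slope is small against the slope of `χ₁` and the
gap hypothesis holds for `Γ = sup |G|`. [folklore] -/
theorem nonempty_sectorThreeParams {L Γ σ₀ : ℝ} (hL : ∀ s, |deriv T.D.χ₁ s| ≤ L)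
    (hκ : T.D.κ * L * T.D.χ₂.rOut ≤ 1 / 4) (hΓ : ∀ x, |B.gFun x| ≤ Γ) (hσ : 0 < σ₀) (hσδ : 2 * σ₀ ≤ B.U.δ)
    (hgap : ∀ q, IsMCriticalPt (𝓡 4) B.f q → B.f q ≤ T.c ∨ T.c + Γ + T.ε + σ₀ < B.f q) :
    Nonempty T.SectorThreeParams :=
  ⟨⟨2 * (B.U.δ + T.D.κ * T.D.χ₂.rOut), Γ, σ₀, L, le_rfl, hΓ, hσ, hσδ, hL, hκ, hgap⟩⟩

namespace SectorThreeParams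

variable {T} (P : T.SectorThreeParams)

/-- `0 ≤ Γ`. [folklore] -/
theorem Γ_nonneg : 0 ≤ P.Γ := (abs_nonneg _).trans (P.abs_gFun_le (Classical.choice ⟨B.π (Classical.choice B.nonempty_Y |> fun y => RegularLevel.incl B.hf y)⟩))

/-- `0 < c₀`. [folklore] -/
theorem c₀_pos : 0 < P.c₀ := by
  have h := P.c₀_ge
  have h1 := B.U.δ_pos
  have h2 : 0 ≤ T.D.κ * T.D.χ₂.rOut := mul_nonneg T.D.κ_pos.le T.D.χ₂.rOut_pos.le
  linarith

/-- **The height of the increasing zone of `Ξ`**: `S = c + Γ + ε - a` (`f* - a`). [folklore] -/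
def S : ℝ := T.c + P.Γ + T.ε - B.a

/-- `2σ₀ ≤ S` (`2σ₀ ≤ δ_U ≤ c - a ≤ S`). [folklore] -/
theorem two_mul_σ₀_le_S : 2 * P.σ₀ ≤ P.S := by
  have h1 := P.σ₀_le
  have h2 := T.band_le_c
  have h3 := P.Γ_nonneg
  have h4 := T.ε_pos
  simp only [S]; linarith

/-- `0 ≤ S`. [folklore] -/
theorem S_nonneg : 0 ≤ P.S := by
  have h2 := T.band_le_c
  have h3 := P.Γ_nonneg
  have h4 := T.ε_pos
  have h5 := B.U.δ_pos
  simp only [S]; linarith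

/-- `δ_U ≤ S`. [folklore] -/
theorem δ_le_S : B.U.δ ≤ P.S := by
  have h2 := T.band_le_c
  have h3 := P.Γ_nonneg
  have h4 := T.ε_pos
  simp only [S]; linarith

include P in
/-- The error bound of the flow derivatives of the face functions: `|err| ≤ 1/4`. [folklore] -/
theorem abs_err_le (x : X) : |T.D.err x| ≤ 1 / 4 := by
  have h1 : |T.D.χ₂ (B.rFun x) * B.rFun x| ≤ T.D.χ₂.rOut := by
    rw [abs_mul, abs_of_nonneg T.D.χ₂.nonneg]; exact T.D.χ₂_mul_abs_le _
  have h2 := P.abs_deriv_le (B.sFun x)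
  have hL0 : 0 ≤ P.L := (abs_nonneg _).trans (P.abs_deriv_le 0)
  rw [BevelData.err, abs_mul, abs_mul, abs_of_pos T.D.κ_pos]
  calc T.D.κ * (|deriv T.D.χ₁ (B.sFun x)| * |T.D.χ₂ (B.rFun x) * B.rFun x|) ≤ T.D.κ * (P.L * T.D.χ₂.rOut) := by
        apply mul_le_mul_of_nonneg_left _ T.D.κ_pos.le
        exact mul_le_mul h2 h1 (abs_nonneg _) hL0
    _ ≤ 1 / 4 := by rw [← mul_assoc]; exact P.hκ

/-! ### The functions `ω`, `Ξ ∘ s`, `Λ₃` and the function `F₃` -/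

/-- **`Ξ ∘ s`.** [folklore] -/
def xiS (x : X) : ℝ := xiFun P.σ₀ P.S (B.sFun x)

/-- **`Λ₃ = (1 - ω) (−U)/c₀ + ω Ξ(s)`.** [cite: GayKirby2016, §4, Lemma 14] -/
def Lam (x : X) : ℝ := (1 - T.omegaFun x) * (-T.D.faceU x * P.c₀⁻¹) + T.omegaFun x * P.xiS x

/-- **The adapted function on `X₃`**: `F₃ = 1 - M̃ Λ₃`. [cite: GayKirby2016, §4, Lemma 14] -/
def secFun₃ (x : X) : ℝ := 1 - T.Mt x * P.Lam x

/-- `1 ≤ Ξ ∘ s`. [folklore] -/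
theorem one_le_xiS (x : X) : 1 ≤ P.xiS x := one_le_xiFun P.σ₀_pos P.S_nonneg _

/-- **On the box, `Λ₃ = u₃ / c₀`** (`ω = 0`, `−U = s + κ r = u₃`). [cite: GayKirby2016, Def. 1 and Fig. 1] -/
theorem Lam_of_mem_box {x : X} (hx : x ∈ B.box T.D.εw) : P.Lam x = B.uFun T.frame₃ x / P.c₀ := by
  rw [Lam, T.omegaFun_of_le (abs_lt.1 hx.1).2.le, T.D.faceU_eq_uFun_of_mem_box hx, T.uFun_frame₃]
  show (1 - 0) * (-(-1 * B.sFun x + -T.D.κ * B.rFun x) * P.c₀⁻¹) + 0 * P.xiS x = (B.sFun x + T.D.κ * B.rFun x) / P.c₀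
  ring

/-- **On the box, `F₃` is the corner form `1 - u₃ v₃ / c₀`.** [cite: GayKirby2016, Def. 1 and Fig. 1] -/
theorem secFun₃_of_mem_box {x : X} (hx : x ∈ B.box T.D.εw) :
    P.secFun₃ x = 1 - B.uFun T.frame₃ x * B.vFun T.frame₃ x / P.c₀ := by
  rw [secFun₃, T.Mt_of_mem_box hx, P.Lam_of_mem_box hx]; ring

section Values

variable (hc2 : B.a + B.U.δ + 2 * T.ε ≤ T.c) {η : ℝ} (hη : 2 * T.ε ≤ η)
  (hL : ∀ q : X, IsMCriticalPt (𝓡 4) B.f q → B.a < B.f q → B.f q ≤ T.c →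
    ∀ y : B.Y, RegularLevel.incl B.hf y ∈ stableSet (𝓡 4) B.U.ξ q → B.g y < B.b - η)

include hc2 in
/-- **On the bevel face `{F₁ = 0} ∩ X₃`, `Λ₃ = 0`** (there `r ≥ 0`, so `U = -F₁ = 0`, and
`s ≤ 0 ≤ ε_w`, so `ω = 0`). [cite: GayKirby2016, §4, Lemma 14] -/
theorem Lam_eq_zero_of_F₁_eq_zero {x : X} (hx3 : x ∈ T.X₃) (h0 : T.D.F₁ x = 0) : P.Lam x = 0 := by
  have hr : 0 ≤ B.rFun x := by
    by_cases hs : x ∈ B.surface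
    · exact ((B.mem_surface_iff x).1 hs).2.ge
    · exact (T.rFun_pos_of_mem_X₃ hc2 hx3 h0 hs).le
  have hU : T.D.faceU x = 0 := by have := T.D.F₁_eq_neg_faceU hr; linarith
  have hs : B.sFun x ≤ 0 := T.D.sFun_nonpos_of_mem_sector (T.D.mem_sector_iff.2 h0.le)
  rw [Lam, hU, T.omegaFun_of_le (hs.trans T.D.εw_pos.le)]; ring

include hc2 in
/-- **`F₃ = 1` on `∂X₃`**: on the bevel face `Λ₃ = 0`, on `{M̃ = 0}` trivially, and the points of
`F` lie on the bevel face. [cite: GayKirby2016, §4, Lemma 14] -/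
theorem secFun₃_eq_one_of_boundary {x : X} (hx3 : x ∈ T.X₃)
    (h : x ∈ B.surface ∨ T.D.F₁ x = 0 ∨ T.Mt x = 0) : P.secFun₃ x = 1 := by
  rcases h with hs | h0 | hM
  · rw [secFun₃, P.Lam_eq_zero_of_F₁_eq_zero hc2 hx3 (T.D.F₁_eq_zero_of_mem_surface hs)]; ring
  · rw [secFun₃, P.Lam_eq_zero_of_F₁_eq_zero hc2 hx3 h0]; ring
  · rw [secFun₃, hM]; ring

include hc2 in
/-- In `X₃`, in the band, `U ≤ 0`. [folklore] -/
theorem faceU_nonpos_of_mem_X₃ {x : X} (hx3 : x ∈ T.X₃) (hband : |B.sFun x| < B.U.δ) : T.D.faceU x ≤ 0 := by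
  have hxb : x ∈ B.U.band := B.mem_band_U hband
  have hh : B.Hit x := B.hit_of_mem_band hxb
  have hr : 0 ≤ B.rFun x := by
    have hM := T.M_nonneg_of_mem_X₃ hh hx3
    by_contra hr
    exact absurd ((T.M_neg_iff_of_mem_band hc2 hxb).2 (not_le.1 hr)) (not_lt.2 hM)
  have h0 := T.F₁_nonneg_of_mem_X₃ hx3
  rw [T.D.F₁_eq_neg_faceU hr] at h0
  linarith

/-- In `X₃`, the band bound `−U ≤ δ_U + κ rOut₂ ≤ c₀/2`. [folklore] -/
theorem neg_faceU_le (x : X) (hband : |B.sFun x| < B.U.δ) : -T.D.faceU x ≤ P.c₀ / 2 := by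
  have h1 := T.D.faceV_le x   -- `V ≤ |s| + κ rOut₂`; and `-U = V - 2κχ₁χ₂ r`… use `U + V = -2s`
  have h2 := T.D.faceU_add_faceV x
  have h3 := P.c₀_ge
  have h4 : -T.D.faceU x ≤ |B.sFun x| + T.D.κ * T.D.χ₂.rOut := by
    -- `-U = s + κχ₁χ₂ r ≤ |s| + κ rOut₂`
    rw [T.D.faceU_eq]
    have hb := T.D.bevel_term_le x
    have : T.D.κ * (T.D.χ₁ (B.sFun x) * (T.D.χ₂ (B.rFun x) * B.rFun x)) ≤
        T.D.κ * (T.D.χ₁ (B.sFun x) * (T.D.χ₂ (B.rFun x) * |B.rFun x|)) := by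
      have hk : 0 ≤ T.D.κ * (T.D.χ₁ (B.sFun x) * T.D.χ₂ (B.rFun x)) :=
        mul_nonneg T.D.κ_pos.le (mul_nonneg T.D.χ₁.nonneg T.D.χ₂.nonneg)
      have := le_abs_self (B.rFun x)
      nlinarith
    linarith [le_abs_self (B.sFun x)]
  linarith [hband.le]

include hc2 in
/-- **`Λ₃ ≥ 0` on `X₃`, and `Λ₃ > 0` off the bevel face.** [folklore] -/
theorem Lam_pos_of_mem_X₃ {x : X} (hx3 : x ∈ T.X₃) (h0 : T.D.F₁ x ≠ 0) : 0 < P.Lam x := by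
  obtain ⟨hw0, hw1⟩ := T.omegaFun_mem x
  have hΞ := P.one_le_xiS x
  have hc₀ := P.c₀_pos
  rw [Lam]
  rcases hw1.lt_or_eq with hlt | heq
  · -- `ω < 1`: band, `U ≤ 0`, and `U ≠ 0` off the bevel face (as `F₁ = -U` for `r ≥ 0`)
    have hs := T.sFun_lt_of_omegaFun_lt_one hlt
    have hband : |B.sFun x| < B.U.δ := by
      have hx3s : B.a - B.U.δ < B.f x := by
        -- points of `X₃` lie above `a - δ_U` (`F₁ ≥ 0` forces `s ≥ -κ rOut₂ > -δ_U`)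
        have h1 := T.F₁_nonneg_of_mem_X₃ hx3
        have h2 := T.D.bevel_term_le x
        have h3 := T.D.κ_mul_rOut₂_lt
        have h4 := T.D.rIn₁_lt
        have : T.D.F₁ x = B.sFun x + T.D.κ * T.D.θ x := rfl
        rw [this, BevelData.θ] at h1
        rw [B.f_eq_add_sFun]
        linarith
      rw [abs_lt, B.f_eq_add_sFun] at *
      constructor <;> linarith [T.mid_lt_δ]
    have hU := faceU_nonpos_of_mem_X₃ hc2 hx3 hband
    have hUne : T.D.faceU x ≠ 0 := by
      intro hU0
      have hxb : x ∈ B.U.band := B.mem_band_U hband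
      have hr : 0 ≤ B.rFun x := by
        have hM := T.M_nonneg_of_mem_X₃ (B.hit_of_mem_band hxb) hx3
        by_contra hr
        exact absurd ((T.M_neg_iff_of_mem_band hc2 hxb).2 (not_le.1 hr)) (not_lt.2 hM)
      exact h0 (by rw [T.D.F₁_eq_neg_faceU hr, hU0, neg_zero])
    have hUpos : 0 < -T.D.faceU x * P.c₀⁻¹ := mul_pos (by
      rcases hU.lt_or_eq with h | h
      · linarith
      · exact absurd h hUne) (inv_pos.2 hc₀)
    have : 0 ≤ T.omegaFun x * P.xiS x := mul_nonneg hw0 (by linarith)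
    nlinarith
  · rw [heq]; linarith

include hc2 hη hL in
/-- **`F₃ < 1` at the interior points of `X₃`** (`M̃ > 0`, `Λ₃ > 0`). [cite: GayKirby2016, §4, Lemma 14] -/
theorem secFun₃_lt_one_of_interior {x : X} (hx3 : x ∈ T.X₃) (h0 : T.D.F₁ x ≠ 0) (hM : T.Mt x ≠ 0) :
    P.secFun₃ x < 1 := by
  have hMpos : 0 < T.Mt x := lt_of_le_of_ne (T.Mt_nonneg_of_mem_X₃ hη hL hx3) (Ne.symm hM)
  have hΛ := P.Lam_pos_of_mem_X₃ hc2 hx3 h0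
  rw [secFun₃]
  nlinarith

end Values

/-! ### The raised top level attached to the parameters -/

/-- **The auxiliary top level** `c + Γ + ε + σ₀/2` (regular by the gap hypothesis). [folklore] -/
def cTop : ℝ := T.c + P.Γ + T.ε + P.σ₀ / 2

/-- `c ≤ cTop`. [folklore] -/
theorem c_le_cTop : T.c ≤ P.cTop := by
  have := P.Γ_nonneg; have := T.ε_pos; have := P.σ₀_pos; simp only [cTop]; linarith

/-- `c + Γ + ε < cTop`. [folklore] -/
theorem lt_cTop : T.c + P.Γ + T.ε < P.cTop := by
  have := P.σ₀_pos; simp only [cTop]; linarith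

/-- `cTop` is a regular value of `f` (gap hypothesis). [folklore] -/
theorem regular_cTop : ∀ x, B.f x = P.cTop → ¬ IsMCriticalPt (𝓡 4) B.f x := fun x hx hc => by
  rcases P.gap x hc with h | h
  · have := P.lt_cTop; have := P.c_le_cTop; simp only [cTop] at *; linarith [P.Γ_nonneg, T.ε_pos]
  · simp only [cTop] at hx; linarith [P.σ₀_pos]

/-- The link condition up to `cTop` follows from the link condition up to `c` (gap). [folklore] -/
theorem hL_cTop {η : ℝ}
    (hL : ∀ q : X, IsMCriticalPt (𝓡 4) B.f q → B.a < B.f q → B.f q ≤ T.c →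
      ∀ y : B.Y, RegularLevel.incl B.hf y ∈ stableSet (𝓡 4) B.U.ξ q → B.g y < B.b - η) :
    ∀ q : X, IsMCriticalPt (𝓡 4) B.f q → B.a < B.f q → B.f q ≤ P.cTop →
      ∀ y : B.Y, RegularLevel.incl B.hf y ∈ stableSet (𝓡 4) B.U.ξ q → B.g y < B.b - η := by
  intro q hq h1 h2 y hy
  rcases P.gap q hq with h | h
  · exact hL q hq h1 h y hy
  · simp only [cTop] at h2; linarith [P.σ₀_pos]

section Smooth

variable {η : ℝ} (hη : 2 * T.ε ≤ η)
  (hL : ∀ q : X, IsMCriticalPt (𝓡 4) B.f q → B.a < B.f q → B.f q ≤ T.c →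
    ∀ y : B.Y, RegularLevel.incl B.hf y ∈ stableSet (𝓡 4) B.U.ξ q → B.g y < B.b - η)

include P hη hL in
/-- **`M̃` is smooth at every point of `X₃`** (for the parameters `P`). [folklore] -/
theorem contMDiffAt_Mt {x : X} (hx3 : x ∈ T.X₃) : ContMDiffAt (𝓡 4) 𝓘(ℝ, ℝ) ∞ T.Mt x :=
  T.contMDiffAt_Mt P.c_le_cTop P.regular_cTop hη (P.hL_cTop hL) P.abs_gFun_le P.lt_cTop hx3

include P hη hL in
/-- Near a point of `X₃` which does not hit, `M̃ = f - c`. [folklore] -/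
theorem Mt_eventuallyEq_sub_of_not_hit' {x : X} (hx3 : x ∈ T.X₃) (hx : ¬ B.Hit x) :
    T.Mt =ᶠ[𝓝 x] fun y => B.f y - T.c := by
  have hcx := T.c_le_f_of_mem_X₃_of_not_hit hη hL hx3 hx
  by_cases hxc : B.f x ≤ P.cTop
  · exact T.Mt_eventuallyEq_sub_of_not_hit P.c_le_cTop P.regular_cTop hη (P.hL_cTop hL) hx hcx hxc
  · exact T.Mt_eventuallyEq_sub_of_lt_f P.abs_gFun_le (by linarith [not_le.1 hxc, P.lt_cTop])

end Smooth

omit [T2Space X] [CompactSpace X] in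
/-- `ω` is smooth. [folklore] -/
theorem _root_.Literature.Topology.FourManifolds.BiCollar.TriData.contMDiff_omegaFun (T : B.TriData) :
    ContMDiff (𝓡 4) 𝓘(ℝ, ℝ) ∞ T.omegaFun :=
  contDiff_rampUp.contMDiff.comp B.contMDiff_sFun

/-- `Ξ ∘ s` is smooth. [folklore] -/
theorem contMDiff_xiS : ContMDiff (𝓡 4) 𝓘(ℝ, ℝ) ∞ P.xiS := contDiff_xiFun.contMDiff.comp B.contMDiff_sFun

/-- **`Λ₃` is smooth.** [folklore] -/
theorem contMDiff_Lam : ContMDiff (𝓡 4) 𝓘(ℝ, ℝ) ∞ P.Lam :=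
  ((contMDiff_const.sub T.contMDiff_omegaFun).mul (T.D.contMDiff_faceU.neg.mul contMDiff_const)).add
    (T.contMDiff_omegaFun.mul P.contMDiff_xiS)

/-- **`F₃` is smooth at every point of `X₃`.** [folklore] -/
theorem contMDiffAt_secFun₃ {η : ℝ} (hη : 2 * T.ε ≤ η)
    (hL : ∀ q : X, IsMCriticalPt (𝓡 4) B.f q → B.a < B.f q → B.f q ≤ T.c →
      ∀ y : B.Y, RegularLevel.incl B.hf y ∈ stableSet (𝓡 4) B.U.ξ q → B.g y < B.b - η)
    {x : X} (hx3 : x ∈ T.X₃) : ContMDiffAt (𝓡 4) 𝓘(ℝ, ℝ) ∞ P.secFun₃ x :=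
  contMDiffAt_const.sub ((P.contMDiffAt_Mt hη hL hx3).mul P.contMDiff_Lam.contMDiffAt)

/-! ### Derivatives along the flow -/

section FlowDeriv

variable (p : X)

/-- `s` along the flow has derivative `ξ(f)`. [folklore] -/
theorem _root_.Literature.Topology.FourManifolds.BiCollar.hasDerivAt_sFun_fl (B : BiCollar X) (p : X) :
    HasDerivAt (fun t => B.sFun (B.U.fl p t)) (mlineDeriv (𝓡 4) B.f p (B.U.ξ p)) 0 :=
  (B.hasDerivAt_f_fl p).sub_const B.a

/-- `ω` along the flow. [folklore] -/
theorem _root_.Literature.Topology.FourManifolds.BiCollar.TriData.hasDerivAt_omegaFun_fl (T : B.TriData) (p : X) :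
    HasDerivAt (fun t => T.omegaFun (B.U.fl p t))
    (deriv (rampUp (T.D.εw + T.σω) (T.sMid - T.σω) T.σω) (B.sFun p) * mlineDeriv (𝓡 4) B.f p (B.U.ξ p)) 0 := by
  have hin := B.hasDerivAt_sFun_fl p
  have hout : HasDerivAt (rampUp (T.D.εw + T.σω) (T.sMid - T.σω) T.σω)
      (deriv (rampUp (T.D.εw + T.σω) (T.sMid - T.σω) T.σω) (B.sFun p)) (B.sFun (B.U.fl p 0)) := by
    rw [B.U.fl_zero]; exact (hasDerivAt_rampUp T.σω_pos _).differentiableAt.hasDerivAt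
  exact hout.comp (0 : ℝ) hin

/-- `Ξ ∘ s` along the flow. [folklore] -/
theorem hasDerivAt_xiS_fl : HasDerivAt (fun t => P.xiS (B.U.fl p t))
    (deriv (xiFun P.σ₀ P.S) (B.sFun p) * mlineDeriv (𝓡 4) B.f p (B.U.ξ p)) 0 := by
  have hin := B.hasDerivAt_sFun_fl p
  have hout : HasDerivAt (xiFun P.σ₀ P.S) (deriv (xiFun P.σ₀ P.S) (B.sFun p)) (B.sFun (B.U.fl p 0)) := by
    rw [B.U.fl_zero]; exact (hasDerivAt_xiFun P.σ₀_pos _).differentiableAt.hasDerivAt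
  exact hout.comp (0 : ℝ) hin

omit [T2Space X] [CompactSpace X] in
/-- The derivative of `ω ∘ s` is `≥ 0` where `ξ(f) ≥ 0`. [folklore] -/
theorem _root_.Literature.Topology.FourManifolds.BiCollar.TriData.omega'_nonneg (T : B.TriData) (p : X)
    (hφ : 0 ≤ mlineDeriv (𝓡 4) B.f p (B.U.ξ p)) :
    0 ≤ deriv (rampUp (T.D.εw + T.σω) (T.sMid - T.σω) T.σω) (B.sFun p) * mlineDeriv (𝓡 4) B.f p (B.U.ξ p) :=
  mul_nonneg (deriv_rampUp_nonneg T.σω_pos T.ramp_lt _) hφ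

variable {p}

/-- **`Λ₃` along the flow, on the band**: the derivative is
`(1 - ω)(1 + err)/c₀ + ω' (Ξ - (-U)/c₀) + ω Ξ'` (`ξ(f) = 1` there). [folklore] -/
theorem hasDerivAt_Lam_fl_band (hp : |B.sFun p| < B.U.δ) :
    HasDerivAt (fun t => P.Lam (B.U.fl p t))
      (-(deriv (rampUp (T.D.εw + T.σω) (T.sMid - T.σω) T.σω) (B.sFun p) * mlineDeriv (𝓡 4) B.f p (B.U.ξ p)) *
          (-T.D.faceU p * P.c₀⁻¹) +
        (1 - T.omegaFun p) * (-(-1 - T.D.err p) * P.c₀⁻¹) +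
        (deriv (rampUp (T.D.εw + T.σω) (T.sMid - T.σω) T.σω) (B.sFun p) * mlineDeriv (𝓡 4) B.f p (B.U.ξ p) *
            P.xiS p +
          T.omegaFun p * (deriv (xiFun P.σ₀ P.S) (B.sFun p) * mlineDeriv (𝓡 4) B.f p (B.U.ξ p)))) 0 := by
  have hω := T.hasDerivAt_omegaFun_fl p
  have hU := T.D.hasDerivAt_faceU_fl hp
  have hΞ := P.hasDerivAt_xiS_fl p
  have h1 := (hω.const_sub 1).mul ((hU.neg).mul_const P.c₀⁻¹)
  have h2 := hω.mul hΞ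
  have h := h1.add h2
  refine (h.congr_of_eventuallyEq (Eventually.of_forall fun t => rfl)).congr_deriv ?_
  simp only [Pi.neg_apply, B.U.fl_zero]

/-- **`Λ₃` along the flow, above `sMid`**: `Λ₃ = Ξ ∘ s` near the point, derivative `Ξ' ξ(f)`. [folklore] -/
theorem hasDerivAt_Lam_fl_above (hp : T.sMid < B.sFun p) :
    HasDerivAt (fun t => P.Lam (B.U.fl p t)) (deriv (xiFun P.σ₀ P.S) (B.sFun p) * mlineDeriv (𝓡 4) B.f p (B.U.ξ p)) 0 := by
  have hev : (fun t => P.Lam (B.U.fl p t)) =ᶠ[𝓝 0] fun t => P.xiS (B.U.fl p t) := by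
    have hc : ContinuousAt (fun t => B.sFun (B.U.fl p t)) 0 := (B.hasDerivAt_sFun_fl p).continuousAt
    have hmem : ∀ᶠ t in 𝓝 (0 : ℝ), T.sMid < B.sFun (B.U.fl p t) :=
      hc.eventually (isOpen_Ioi.mem_nhds (by show T.sMid < B.sFun (B.U.fl p 0); rwa [B.U.fl_zero]))
    filter_upwards [hmem] with t ht
    rw [Lam, T.omegaFun_of_ge ht.le]; ring
  exact (P.hasDerivAt_xiS_fl p).congr_of_eventuallyEq hev

/-- **`M̃` along the flow at a point which hits**: derivative `σ_ε'(w) ξ(f)`. [folklore] -/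
theorem _root_.Literature.Topology.FourManifolds.BiCollar.TriData.hasDerivAt_Mt_fl_of_hit (T : B.TriData) {p : X}
    (hp : B.Hit p) :
    HasDerivAt (fun t => T.Mt (B.U.fl p t)) (creaseStep (T.w p / T.ε) * mlineDeriv (𝓡 4) B.f p (B.U.ξ p)) 0 := by
  have hev : (fun t => T.Mt (B.U.fl p t)) =ᶠ[𝓝 0] fun t => T.M (B.U.fl p t) := by
    have hc : ContinuousAt (fun t => B.U.fl p t) 0 := (B.contMDiff_fl_right p).continuous.continuousAt
    have h := T.Mt_eventuallyEq_M hp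
    rw [← B.U.fl_zero p] at h
    exact hc.eventually h
  exact (T.hasDerivAt_M_fl hp).congr_of_eventuallyEq hev

include P in
/-- **`M̃` along the flow at a point of `X₃` which does not hit**: derivative `ξ(f)`. [folklore] -/
theorem hasDerivAt_Mt_fl_of_not_hit {η : ℝ} (hη : 2 * T.ε ≤ η)
    (hL : ∀ q : X, IsMCriticalPt (𝓡 4) B.f q → B.a < B.f q → B.f q ≤ T.c →
      ∀ y : B.Y, RegularLevel.incl B.hf y ∈ stableSet (𝓡 4) B.U.ξ q → B.g y < B.b - η)
    (hp3 : p ∈ T.X₃) (hp : ¬ B.Hit p) :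
    HasDerivAt (fun t => T.Mt (B.U.fl p t)) (mlineDeriv (𝓡 4) B.f p (B.U.ξ p)) 0 := by
  have hev : (fun t => T.Mt (B.U.fl p t)) =ᶠ[𝓝 0] fun t => B.f (B.U.fl p t) - T.c := by
    have hc : ContinuousAt (fun t => B.U.fl p t) 0 := (B.contMDiff_fl_right p).continuous.continuousAt
    have h := P.Mt_eventuallyEq_sub_of_not_hit' hη hL hp3 hp
    rw [← B.U.fl_zero p] at h
    exact hc.eventually h
  exact ((B.hasDerivAt_f_fl p).sub_const T.c).congr_of_eventuallyEq hev

include P in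
/-- **`M̃` along the flow at a point of `X₃`**: derivative `μ ξ(f)` with `μ ∈ [0, 1]`, `μ = 1`
unless the point hits with `w < ε`. [folklore] -/
theorem hasDerivAt_Mt_fl {η : ℝ} (hη : 2 * T.ε ≤ η)
    (hL : ∀ q : X, IsMCriticalPt (𝓡 4) B.f q → B.a < B.f q → B.f q ≤ T.c →
      ∀ y : B.Y, RegularLevel.incl B.hf y ∈ stableSet (𝓡 4) B.U.ξ q → B.g y < B.b - η)
    (hp3 : p ∈ T.X₃) :
    ∃ μ : ℝ, 0 ≤ μ ∧ μ ≤ 1 ∧ (B.Hit p → T.ε ≤ T.w p → μ = 1) ∧ (¬ B.Hit p → μ = 1) ∧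
      HasDerivAt (fun t => T.Mt (B.U.fl p t)) (μ * mlineDeriv (𝓡 4) B.f p (B.U.ξ p)) 0 := by
  by_cases hh : B.Hit p
  · refine ⟨creaseStep (T.w p / T.ε), creaseStep_nonneg _, creaseStep_le_one _, fun _ hw => ?_,
      fun h => absurd hh h, T.hasDerivAt_Mt_fl_of_hit hh⟩
    exact creaseStep_of_one_le (by rw [le_div_iff₀ T.ε_pos]; linarith)
  · exact ⟨1, zero_le_one, le_rfl, fun h => absurd h hh, fun _ => rfl,
      by simpa only [one_mul] using P.hasDerivAt_Mt_fl_of_not_hit hη hL hp3 hh⟩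

end FlowDeriv

/-! ### Monotonicity along the flow: no critical points inside, regular bevel face -/

section Mono

variable (hc2 : B.a + B.U.δ + 2 * T.ε ≤ T.c) {η : ℝ} (hη : 2 * T.ε ≤ η)
  (hL : ∀ q : X, IsMCriticalPt (𝓡 4) B.f q → B.a < B.f q → B.f q ≤ T.c →
    ∀ y : B.Y, RegularLevel.incl B.hf y ∈ stableSet (𝓡 4) B.U.ξ q → B.g y < B.b - η)

/-- Points of `X₃` lie above `a - δ_U`. [folklore] -/
theorem _root_.Literature.Topology.FourManifolds.BiCollar.TriData.sFun_gt_of_mem_X₃ (T : B.TriData) {x : X}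
    (hx3 : x ∈ T.X₃) : -B.U.δ < B.sFun x := by
  have h1 := T.F₁_nonneg_of_mem_X₃ hx3
  have h2 := T.D.bevel_term_le x
  have h3 := T.D.κ_mul_rOut₂_lt
  have h4 := T.D.rIn₁_lt
  have : T.D.F₁ x = B.sFun x + T.D.κ * T.D.θ x := rfl
  rw [this, BevelData.θ] at h1
  linarith

/-- **On the band, the flow derivative of `Λ₃` is positive.** [folklore] -/
theorem flowDeriv_Lam_pos_band {p : X} (hp : |B.sFun p| < B.U.δ) :
    ∃ d : ℝ, 0 < d ∧ HasDerivAt (fun t => P.Lam (B.U.fl p t)) d 0 := by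
  refine ⟨_, ?_, P.hasDerivAt_Lam_fl_band hp⟩
  -- on the band `ξ(f) = 1`
  have hφ : mlineDeriv (𝓡 4) B.f p (B.U.ξ p) = 1 :=
    B.U.mlineDeriv_eq_one p (by rw [B.f_eq_add_sFun]; constructor <;> linarith [(abs_lt.1 hp).1, (abs_lt.1 hp).2])
  rw [hφ]
  set ω' := deriv (rampUp (T.D.εw + T.σω) (T.sMid - T.σω) T.σω) (B.sFun p) with hω'
  have hω'0 : 0 ≤ ω' := deriv_rampUp_nonneg T.σω_pos T.ramp_lt _
  obtain ⟨hw0, hw1⟩ := T.omegaFun_mem p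
  have herr := abs_le.1 (P.abs_err_le p)
  have hΞ := P.one_le_xiS p
  have hΞ' : 0 ≤ deriv (xiFun P.σ₀ P.S) (B.sFun p) := deriv_xiFun_nonneg P.σ₀_pos P.S_nonneg _
  have hc₀ := P.c₀_pos
  have hinv : 0 < P.c₀⁻¹ := inv_pos.2 hc₀
  have hU := P.neg_faceU_le p hp          -- `-U ≤ c₀/2`
  have hUc : -T.D.faceU p * P.c₀⁻¹ ≤ 1 / 2 := by
    rw [← div_eq_mul_inv, div_le_iff₀ hc₀]; linarith
  -- the expression is `(1-ω)(1+err)/c₀ + ω'(Ξ - (-U)/c₀) + ω Ξ'`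
  have key : -(ω' * 1) * (-T.D.faceU p * P.c₀⁻¹) + (1 - T.omegaFun p) * (-(-1 - T.D.err p) * P.c₀⁻¹) +
      (ω' * 1 * P.xiS p + T.omegaFun p * (deriv (xiFun P.σ₀ P.S) (B.sFun p) * 1)) =
      (1 - T.omegaFun p) * ((1 + T.D.err p) * P.c₀⁻¹) + ω' * (P.xiS p - -T.D.faceU p * P.c₀⁻¹) +
        T.omegaFun p * deriv (xiFun P.σ₀ P.S) (B.sFun p) := by ring
  rw [key]
  have t2 : 0 ≤ ω' * (P.xiS p - -T.D.faceU p * P.c₀⁻¹) :=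
    mul_nonneg hω'0 (sub_nonneg.2 (hUc.trans (by linarith : (1 : ℝ) / 2 ≤ P.xiS p)))
  have t3 : 0 ≤ T.omegaFun p * deriv (xiFun P.σ₀ P.S) (B.sFun p) := mul_nonneg hw0 hΞ'
  rcases hw1.lt_or_eq with hlt | heq
  · have t1 : 0 < (1 - T.omegaFun p) * ((1 + T.D.err p) * P.c₀⁻¹) :=
      mul_pos (by linarith) (mul_pos (by linarith) hinv)
    linarith
  · -- `ω = 1`: then `s > ε_w > 0 > -σ₀` and `s < δ_U ≤ S < S + σ₀`, so `Ξ' > 0`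
    have hs : T.D.εw < B.sFun p := by
      by_contra h; exact absurd heq (by rw [T.omegaFun_of_le (not_lt.1 h)]; norm_num)
    have hΞ'pos : 0 < deriv (xiFun P.σ₀ P.S) (B.sFun p) :=
      deriv_xiFun_pos P.σ₀_pos P.two_mul_σ₀_le_S (by linarith [T.D.εw_pos, P.σ₀_pos])
        (by linarith [(abs_lt.1 hp).2, P.δ_le_S, P.σ₀_pos])
    have t3' : 0 < T.omegaFun p * deriv (xiFun P.σ₀ P.S) (B.sFun p) := by rw [heq, one_mul]; exact hΞ'pos
    have t1 : 0 ≤ (1 - T.omegaFun p) * ((1 + T.D.err p) * P.c₀⁻¹) := by rw [heq, sub_self, zero_mul]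
    linarith

include hc2 hη hL in
/-- **`F₃` strictly decreases along the flow at every interior point of `X₃` which is not a
critical point of `f`.** [cite: GayKirby2016, §4, Lemma 14] -/
theorem flowDeriv_secFun₃_neg {p : X} (hp3 : p ∈ T.X₃) (h0 : T.D.F₁ p ≠ 0) (hM : T.Mt p ≠ 0)
    (hcrit : ¬ IsMCriticalPt (𝓡 4) B.f p) :
    ∃ d : ℝ, d < 0 ∧ HasDerivAt (fun t => P.secFun₃ (B.U.fl p t)) d 0 := by
  have hφ : 0 < mlineDeriv (𝓡 4) B.f p (B.U.ξ p) := T.Fr.isGradientLike.mlineDeriv_pos p hcrit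
  have hMpos : 0 < T.Mt p := lt_of_le_of_ne (T.Mt_nonneg_of_mem_X₃ hη hL hp3) (Ne.symm hM)
  have hΛ : 0 < P.Lam p := P.Lam_pos_of_mem_X₃ hc2 hp3 h0
  obtain ⟨μ, hμ0, hμ1, hμw, hμh, hMt⟩ := P.hasDerivAt_Mt_fl hη hL hp3
  by_cases hband : |B.sFun p| < B.U.δ
  · obtain ⟨d, hd, hΛd⟩ := P.flowDeriv_Lam_pos_band hband
    refine ⟨_, ?_, (hMt.mul hΛd).const_sub 1⟩
    simp only [B.U.fl_zero]
    have h1 : 0 ≤ μ * mlineDeriv (𝓡 4) B.f p (B.U.ξ p) * P.Lam p := by positivity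
    have h2 : 0 < T.Mt p * d := mul_pos hMpos hd
    linarith
  · -- off the band: `s ≥ δ_U > sMid`, `Λ₃ = Ξ ∘ s` near `p`
    have hs : B.U.δ ≤ B.sFun p := by
      have h1 := not_lt.1 hband
      have h2 := T.sFun_gt_of_mem_X₃ hp3
      rw [abs_of_nonneg (by by_contra h; rw [abs_of_neg (not_le.1 h)] at h1; linarith)] at h1
      exact h1
    have hΛd := P.hasDerivAt_Lam_fl_above (T.mid_lt_δ.trans_le hs)
    refine ⟨_, ?_, (hMt.mul hΛd).const_sub 1⟩
    simp only [B.U.fl_zero]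
    have hΞ' : 0 ≤ deriv (xiFun P.σ₀ P.S) (B.sFun p) := deriv_xiFun_nonneg P.σ₀_pos P.S_nonneg _
    by_cases htop : B.sFun p < P.S + P.σ₀
    · -- `Ξ' > 0`
      have hΞ'pos : 0 < deriv (xiFun P.σ₀ P.S) (B.sFun p) :=
        deriv_xiFun_pos P.σ₀_pos P.two_mul_σ₀_le_S
          (by linarith [B.U.δ_pos, P.σ₀_pos]) htop
      have h1 : 0 ≤ μ * mlineDeriv (𝓡 4) B.f p (B.U.ξ p) * P.Lam p := by positivity
      have h2 : 0 < T.Mt p * (deriv (xiFun P.σ₀ P.S) (B.sFun p) * mlineDeriv (𝓡 4) B.f p (B.U.ξ p)) :=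
        mul_pos hMpos (mul_pos hΞ'pos hφ)
      linarith
    · -- `s ≥ S + σ₀`: `μ = 1`
      have hμ : μ = 1 := by
        by_cases hh : B.Hit p
        · apply hμw hh
          -- `w = f - c - G ≥ (a + S + σ₀) - c - Γ = ε + σ₀`
          have hG := (abs_le.1 (P.abs_gFun_le p)).2
          have : T.w p = B.f p - T.c - B.gFun p := rfl
          rw [this, B.f_eq_add_sFun]
          have hS : P.S = T.c + P.Γ + T.ε - B.a := rfl
          linarith [not_lt.1 htop, P.σ₀_pos]
        · exact hμh hh
      rw [hμ, one_mul]
      have h1 : 0 ≤ T.Mt p * (deriv (xiFun P.σ₀ P.S) (B.sFun p) * mlineDeriv (𝓡 4) B.f p (B.U.ξ p)) := by positivity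
      have h2 : 0 < mlineDeriv (𝓡 4) B.f p (B.U.ξ p) * P.Lam p := mul_pos hφ hΛ
      linarith

include hc2 hη hL in
/-- **`F₃` has no critical point at the interior points of `X₃` which are not critical for `f`.**
[cite: GayKirby2016, §4, Lemma 14] -/
theorem not_isMCriticalPt_secFun₃_of_interior {p : X} (hp3 : p ∈ T.X₃) (h0 : T.D.F₁ p ≠ 0) (hM : T.Mt p ≠ 0)
    (hcrit : ¬ IsMCriticalPt (𝓡 4) B.f p) : ¬ IsMCriticalPt (𝓡 4) P.secFun₃ p := by
  obtain ⟨d, hd, hderiv⟩ := P.flowDeriv_secFun₃_neg hc2 hη hL hp3 h0 hM hcrit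
  exact not_isMCriticalPt_of_hasDerivAt_comp ((P.contMDiffAt_secFun₃ hη hL hp3).mdifferentiableAt (by simp))
    (B.U.fl_zero p) ((B.contMDiff_fl_right p).mdifferentiableAt (by simp)) hderiv hd.ne

include hc2 hη hL in
/-- **`F₃` is regular at the points of the bevel face off `F`**: there `Λ₃ = 0`, `M̃ = r > 0` and
the flow derivative of `Λ₃` is positive. [cite: GayKirby2016, §4, Lemma 14] -/
theorem not_isMCriticalPt_secFun₃_of_F₁_eq_zero {p : X} (hp3 : p ∈ T.X₃) (h0 : T.D.F₁ p = 0) (hpF : p ∉ B.surface) :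
    ¬ IsMCriticalPt (𝓡 4) P.secFun₃ p := by
  have hband : |B.sFun p| < B.U.δ := (T.D.abs_sFun_lt_rIn_of_F₁_eq_zero h0).trans T.D.rIn₁_lt
  have hxb : p ∈ B.U.band := B.mem_band_U hband
  have hh : B.Hit p := B.hit_of_mem_band hxb
  have hr : 0 < B.rFun p := T.rFun_pos_of_mem_X₃ hc2 hp3 h0 hpF
  have hM : T.Mt p = B.rFun p := by
    rw [T.Mt_of_hit hh]
    rcases T.M_eq_rFun_or_of_mem_band hc2 hxb with h | h
    · exact h
    · linarith [h.2, T.ε_pos]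
  have hΛ0 : P.Lam p = 0 := P.Lam_eq_zero_of_F₁_eq_zero hc2 hp3 h0
  obtain ⟨d, hd, hΛd⟩ := P.flowDeriv_Lam_pos_band hband
  obtain ⟨μ, -, -, -, -, hMt⟩ := P.hasDerivAt_Mt_fl hη hL hp3
  have hderiv := (hMt.mul hΛd).const_sub 1
  simp only [B.U.fl_zero, hΛ0, mul_zero, zero_add] at hderiv
  refine not_isMCriticalPt_of_hasDerivAt_comp ((P.contMDiffAt_secFun₃ hη hL hp3).mdifferentiableAt (by simp))
    (B.U.fl_zero p) ((B.contMDiff_fl_right p).mdifferentiableAt (by simp)) hderiv ?_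
  rw [hM]
  nlinarith

end Mono

/-! ### Regularity at the points of the face `{M̃ = 0}` off `F` -/

omit [T2Space X] [CompactSpace X] [IsManifold (𝓡 4) ∞ X] in
/-- **`1 - F Λ` is regular at a regular zero of `F` where `Λ ≠ 0`** (product rule for
`mfderiv`). [folklore] -/
theorem _root_.Literature.Topology.FourManifolds.not_isMCriticalPt_one_sub_mul {F Λ : X → ℝ} {z : X}
    (hF : MDifferentiableAt (𝓡 4) 𝓘(ℝ, ℝ) F z) (hΛ : MDifferentiableAt (𝓡 4) 𝓘(ℝ, ℝ) Λ z)
    (hF0 : F z = 0) (hΛ0 : Λ z ≠ 0) (hFc : ¬ IsMCriticalPt (𝓡 4) F z) :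
    ¬ IsMCriticalPt (𝓡 4) (fun y => 1 - F y * Λ y) z := by
  intro hc
  have h1 := hF.hasMFDerivAt.mul hΛ.hasMFDerivAt
  rw [hF0, zero_smul, zero_add] at h1
  -- criticality of `1 - FΛ` is criticality of `FΛ`
  have hc' : IsMCriticalPt (𝓡 4) (fun y => (-1) * (F y * Λ y) + 1) z := by
    have : (fun y => (-1) * (F y * Λ y) + 1) = fun y => 1 - F y * Λ y := by funext y; ring
    rw [this]; exact hc
  have hc'' := (isMCriticalPt_const_mul_add_iff (I := 𝓡 4) (neg_ne_zero.2 one_ne_zero) 1 (hF.mul hΛ)).1 hc'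
  have hzero : mfderiv (𝓡 4) 𝓘(ℝ, ℝ) (F * Λ) z = 0 := hc''
  rw [h1.mfderiv] at hzero
  have hzero' : Λ z • (mfderiv (𝓡 4) 𝓘(ℝ, ℝ) F z : TangentSpace (𝓡 4) z →L[ℝ] ℝ) =
      (0 : TangentSpace (𝓡 4) z →L[ℝ] ℝ) := hzero
  rcases smul_eq_zero.1 hzero' with h | h
  · exact hΛ0 h
  · exact hFc h

section FaceM

variable (hc2 : B.a + B.U.δ + 2 * T.ε ≤ T.c) {η : ℝ} (hη : 2 * T.ε ≤ η)
  (hL : ∀ q : X, IsMCriticalPt (𝓡 4) B.f q → B.a < B.f q → B.f q ≤ T.c →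
    ∀ y : B.Y, RegularLevel.incl B.hf y ∈ stableSet (𝓡 4) B.U.ξ q → B.g y < B.b - η)

include hc2 hη hL in
/-- **`F₃` is regular at the points of `{M̃ = 0}` off `F` and off the bevel face**: near such a
point `F₃ = 1 - F Λ₃` for a smooth `F` equal to `M̃` near the point with a regular zero there
(the straightening function of `M` if the point hits — `TriData.strFun` —, `f - c` if not),
and `Λ₃ > 0`. [cite: GayKirby2016, §4, Lemma 14] -/
theorem not_isMCriticalPt_secFun₃_of_Mt_eq_zero {p : X} (hp3 : p ∈ T.X₃) (h0 : T.D.F₁ p ≠ 0) (hM : T.Mt p = 0) :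
    ¬ IsMCriticalPt (𝓡 4) P.secFun₃ p := by
  have hΛ := P.Lam_pos_of_mem_X₃ hc2 hp3 h0
  by_cases hh : B.Hit p
  · have hM0 : T.M p = 0 := by rwa [T.Mt_of_hit hh] at hM
    set F := T.strFun hh hM0 with hFdef
    have hev : P.secFun₃ =ᶠ[𝓝 p] fun y => 1 - F y * P.Lam y := by
      filter_upwards [T.strFun_eventuallyEq hh hM0, T.Mt_eventuallyEq_M hh] with y hy hy'
      rw [secFun₃, hy', ← hy]
    have hev0 : P.secFun₃ =ᶠ[𝓝 p] fun y => (1 - F y * P.Lam y) + 0 :=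
      hev.trans (Eventually.of_forall fun y => (add_zero _).symm)
    rw [isMCriticalPt_congr_of_eventuallyEq_add_const hev0]
    exact not_isMCriticalPt_one_sub_mul ((T.contMDiff_strFun hh hM0).mdifferentiableAt (by simp))
      (P.contMDiff_Lam.mdifferentiableAt (by simp)) (by rw [hFdef, (T.strFun_eventuallyEq hh hM0).eq_of_nhds]; exact hM0)
      hΛ.ne' (T.not_isMCriticalPt_strFun hh hM0)
  · have hfc : B.f p = T.c := by rw [T.Mt_of_not_hit hh] at hM; linarith
    have hev : P.secFun₃ =ᶠ[𝓝 p] fun y => 1 - (B.f y - T.c) * P.Lam y := by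
      filter_upwards [P.Mt_eventuallyEq_sub_of_not_hit' hη hL hp3 hh] with y hy
      rw [secFun₃, hy]
    have hev0 : P.secFun₃ =ᶠ[𝓝 p] fun y => (1 - (B.f y - T.c) * P.Lam y) + 0 :=
      hev.trans (Eventually.of_forall fun y => (add_zero _).symm)
    rw [isMCriticalPt_congr_of_eventuallyEq_add_const hev0]
    refine not_isMCriticalPt_one_sub_mul ((B.U.contMDiff_f.sub contMDiff_const).mdifferentiableAt (by simp))
      (P.contMDiff_Lam.mdifferentiableAt (by simp)) (by show B.f p - T.c = 0; linarith) hΛ.ne' ?_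
    -- `f - c` is regular at `p` since `c` is a regular value
    intro hc
    apply T.regular_c p hfc
    have h := (isMCriticalPt_const_mul_add_iff (I := 𝓡 4) (f := B.f) one_ne_zero (-T.c) (x := p)
      (B.U.contMDiff_f.mdifferentiableAt (by simp))).1
    apply h
    have : (fun y => 1 * B.f y + -T.c) = fun y => B.f y - T.c := by funext y; ring
    rw [this]; exact hc

end FaceM


end SectorThreeParams

end TriData

end BiCollar

end Literature.Topology.FourManifolds

end
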